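import Summits.RiemannHypothesis.RiemannHypothesis.Theorems.EarlyAppointmentsRemainder0XiHeightSumAbelBound
import Summits.RiemannHypothesis.RiemannHypothesis.Theorems.EarlyAppointmentsRemainder0XiEtaLedgerArith

/-!
# ⟨24730⟩ ρ2 v4 — LEAF 2 (`AbelMainLeaf`), LOWER SIDE: the Abel/HSW comparison on `[lowStart, x − 67.5]` PROVED

C4 «kernel desk» rh-idea-6 g30, director (CA406)(d).  SUPPORT module for crux r3 `Remainder0Xi` (line rho2_v4), fully proved,
standard axioms; imports = pre-image `…HeightSumAbelBound` (C4 g30, 089cedc0) + tree `…EtaLedgerArith` (`T_PT`, `boxHalfWidth`,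
`lowStart` mirrors).

The lower far sum of `farHeightSum x T` runs over heights `(0, x − 67.5]` with the increasing kernel `φ_dn(t) = 2x/(x² − t²)`
(`phiDn x`), and MAIN's lower integral is `(1/2π)∫_{14}^{x−67.5} log(t/2π)·φ_dn`.  Here:
★ `lowSide_abel (hx : T_PT − 67.5 ≤ x)`: `|Σᶠ_{14 < Re ρ ≤ x−67.5} ord·φ_dn(Re ρ) − (∫_{14}^{x−67.5} φ_dn·log(t/2π))/(2π)|
   ≤ W_N(x − 67.5) · 2·φ_dn(x − 67.5)`, `W_N(b) = 0.1038 log b + 0.2573 log log b + 10.2425` (`abel_bound_hsw`, `φ_dn' ≥ 0`);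
★ `lowPiece_abs_le`: the heights in `(0, 14]` contribute `≤ 21·φ_dn(14) ≤ 10⁻⁹` (count `≤ N(14) ≤ 21` from the dictionary + HSW at
   `t = 14` — no appeal to the `N(14) = 0` certificate, so standard axioms);
★ `heightBox_split` / `finsum_heightBox_split`: `(0, b] = (0, 14] ⊔ (14, b]`.
So the lower half of LEAF 2 costs `2·W_N(x−67.5)·φ_dn(x−67.5) + 10⁻⁹` with `φ_dn(x − 67.5) = 2x/(67.5·(2x − 67.5))`; the upper half
is the tree's `BrentPlattTrudgian2021_thm2` / `BPT2021.abs_integral_Ioi_count_sub_countMain_mul_deriv_le` route (HANDOFF recipe).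
Nothing here bears on the truth of RH; RH is not proved; 24730 OPEN.
-/

set_option linter.dupNamespace false
namespace Summit.RiemannHypothesis.RiemannHypothesis.Theorems.EarlyAppointmentsRemainder0Xi.AbelLowSide

open Set MeasureTheory intervalIntegral Real
open Literature.NumberTheory.LFunctions
open Literature.NumberTheory.LFunctions.SchoenfeldBound (countMain)
open Summit.RiemannHypothesis.RiemannHypothesis.Cruxes.Remainder0Xi.Rho2V2 (T_PT boxHalfWidth lowStart)
open Summit.RiemannHypothesis.RiemannHypothesis.Theorems.Splittings.EarlyAppointmentsXiZetaDictionary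
  (xiOrd xiOrd_nonneg xiDictHalfOpen_holds)
open Summit.RiemannHypothesis.RiemannHypothesis.Theorems.EarlyAppointmentsRemainder0Xi.HeightSumAbel
  (heightBox heightBox_finite)
open Summit.RiemannHypothesis.RiemannHypothesis.Theorems.EarlyAppointmentsRemainder0Xi.HeightSumAbelBound
  (abel_bound_hsw abs_Q_le_hsw)

/-- the lower kernel `φ_dn(t) = 2x/(x² − t²)` (= MAIN's lower integrand weight) … -/
noncomputable def phiDn (x t : ℝ) : ℝ := 2 * x / (x ^ 2 - t ^ 2)

/-- … and its derivative `4xt/(x² − t²)²` (nonnegative for `t ≥ 0`, `x ≥ 0`). -/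
noncomputable def phiDn' (x t : ℝ) : ℝ := 4 * x * t / (x ^ 2 - t ^ 2) ^ 2

/-- The low-side kernel `phiDn x` has derivative `phiDn' x t` at every `t` with `t² ≠ x²`. -/
theorem hasDerivAt_phiDn {x t : ℝ} (ht : t ^ 2 ≠ x ^ 2) : HasDerivAt (phiDn x) (phiDn' x t) t := by
  have h1 : HasDerivAt (fun s : ℝ ↦ x ^ 2 - s ^ 2) (-(2 * t)) t := by
    have h := ((hasDerivAt_id t).mul (hasDerivAt_id t)).const_sub (x ^ 2)
    have e1 : (fun s : ℝ ↦ x ^ 2 - s ^ 2) = fun s ↦ x ^ 2 - id s * id s := by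
      funext s; simp [sq]
    have e2 : -(2 * t) = -(1 * id t + id t * 1) := by simp; ring
    rw [e1, e2]
    exact h
  have hne : x ^ 2 - t ^ 2 ≠ 0 := sub_ne_zero.2 (Ne.symm ht)
  have h := (hasDerivAt_const t (2 * x)).div h1 hne
  have e : (0 * (x ^ 2 - t ^ 2) - 2 * x * -(2 * t)) / (x ^ 2 - t ^ 2) ^ 2 = 4 * x * t / (x ^ 2 - t ^ 2) ^ 2 := by
    ring
  rw [e] at h
  exact h

/-- ★ (K) **LOWER SIDE of LEAF 2**: for `x ≥ T_PT − 67.5`,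
`|Σᶠ_{Ξρ=0, 14<Re ρ≤x−67.5} ord_ρ·φ_dn(Re ρ) − (∫_{14}^{x−67.5} φ_dn(t)·log(t/2π) dt)/(2π)| ≤ W_N(x−67.5)·(2·φ_dn(x−67.5))`. -/
theorem lowSide_abel {x : ℝ} (hx : T_PT - boxHalfWidth ≤ x) :
    |∑ᶠ ρ ∈ heightBox lowStart (x - boxHalfWidth), ((analyticOrderAt riemannXiUpper ρ).toNat : ℝ) * phiDn x ρ.re
        - (∫ t in lowStart..(x - boxHalfWidth), phiDn x t * Real.log (t / (2 * π))) / (2 * π)|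
      ≤ (0.1038 * Real.log (x - boxHalfWidth) + 0.2573 * Real.log (Real.log (x - boxHalfWidth)) + 10.2425)
          * (2 * phiDn x (x - boxHalfWidth)) := by
  have hT : T_PT = 3000175332800 := rfl
  have hB : boxHalfWidth = 135 / 2 := rfl
  have hL : lowStart = 14 := rfl
  rw [hT, hB] at hx
  rw [hL, hB]
  have hx0 : 0 < x := by linarith
  have hb14 : (14 : ℝ) ≤ x - 135 / 2 := by linarith
  have hlt : ∀ t ∈ Icc (14 : ℝ) (x - 135 / 2), t ^ 2 < x ^ 2 := by
    intro t ht
    have h0 : 0 ≤ t := by linarith [ht.1]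
    nlinarith [ht.2]
  have hφ : ∀ t ∈ Icc (14 : ℝ) (x - 135 / 2), HasDerivAt (phiDn x) (phiDn' x t) t :=
    fun t ht ↦ hasDerivAt_phiDn (hlt t ht).ne
  have hφ' : ContinuousOn (phiDn' x) (Icc 14 (x - 135 / 2)) := by
    unfold phiDn'
    refine ContinuousOn.div (by fun_prop) (by fun_prop) fun t ht ↦ ?_
    exact pow_ne_zero 2 (sub_ne_zero.2 (hlt t ht).ne')
  have hsign : (∀ t ∈ Icc (14 : ℝ) (x - 135 / 2), 0 ≤ phiDn' x t) ∨
      (∀ t ∈ Icc (14 : ℝ) (x - 135 / 2), phiDn' x t ≤ 0) := Or.inl fun t ht ↦ by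
    unfold phiDn'
    have h0 : 0 ≤ t := by linarith [ht.1]
    positivity
  have he : Real.exp 1 ≤ 14 := by linarith [Real.exp_one_lt_d9]
  have h := abel_bound_hsw (a := 14) (b := x - 135 / 2) he hb14 hφ hφ' hsign
  have hpos14 : 0 < phiDn x 14 := by
    unfold phiDn
    exact div_pos (by linarith) (by nlinarith)
  have hmono : phiDn x 14 ≤ phiDn x (x - 135 / 2) := by
    unfold phiDn
    exact div_le_div_of_nonneg_left (by linarith) (by nlinarith) (by nlinarith)
  have hposb : 0 < phiDn x (x - 135 / 2) := lt_of_lt_of_le hpos14 hmono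
  have e3 : |phiDn x 14| + |phiDn x (x - 135 / 2)| + |phiDn x (x - 135 / 2) - phiDn x 14| =
      2 * phiDn x (x - 135 / 2) := by
    rw [abs_of_pos hpos14, abs_of_pos hposb, abs_of_nonneg (by linarith)]
    ring
  rw [e3] at h
  exact h

/-- `(a, c] = (a, b] ∪ (b, c]` for Ξ-height boxes. -/
theorem heightBox_split {a b c : ℝ} (hab : a ≤ b) (hbc : b ≤ c) : heightBox a c = heightBox a b ∪ heightBox b c := by
  ext ρ
  simp only [heightBox, Set.mem_setOf_eq, Set.mem_union]
  constructor
  · rintro ⟨h0, h1, h2⟩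
    rcases le_or_gt ρ.re b with h | h
    · exact Or.inl ⟨h0, h1, h⟩
    · exact Or.inr ⟨h0, h, h2⟩
  · rintro (⟨h0, h1, h2⟩ | ⟨h0, h1, h2⟩)
    · exact ⟨h0, h1, h2.trans hbc⟩
    · exact ⟨h0, lt_of_le_of_lt hab h1, h2⟩

/-- Splitting a height-box sum at an intermediate height `b ∈ [a, c]`. -/
theorem finsum_heightBox_split {a b c : ℝ} (hab : a ≤ b) (hbc : b ≤ c) (F : ℂ → ℝ) :
    ∑ᶠ ρ ∈ heightBox a c, F ρ = (∑ᶠ ρ ∈ heightBox a b, F ρ) + ∑ᶠ ρ ∈ heightBox b c, F ρ := by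
  rw [heightBox_split hab hbc, finsum_mem_union ?_ (heightBox_finite a b) (heightBox_finite b c)]
  exact Set.disjoint_left.2 fun ρ ⟨_, _, h2⟩ ⟨_, h3, _⟩ ↦ by linarith

/-- The multiplicity count of Ξ-zeros at heights in `(0, 14]` is at most `21` (dictionary + HSW at `t = 14`; in truth it is `0`,
`zetaZeroCount_fourteen`, which we do not need). -/
theorem count_low_le : ∑ᶠ u ∈ {u : ℂ | riemannXiUpper u = 0 ∧ 0 < u.re ∧ u.re ≤ lowStart}, xiOrd u ≤ 21 := by
  have hL : lowStart = 14 := rfl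
  rw [xiDictHalfOpen_holds 0 lowStart le_rfl (by rw [hL]; norm_num), hL]
  have he3 : Real.exp 1 < 3 := lt_trans Real.exp_one_lt_d9 (by norm_num)
  have hQ := abs_Q_le_hsw (t := 14) (by linarith)
  have hN0 : (0 : ℝ) ≤ zetaZeroCount 0 := Nat.cast_nonneg _
  have hπ := Real.pi_gt_three
  have hπ4 := Real.pi_lt_four
  -- countMain 14 ≤ 3 and the HSW envelope at 14 ≤ 15
  have hl14 : Real.log 14 ≤ 13 := by linarith [Real.log_le_sub_one_of_pos (by norm_num : (0 : ℝ) < 14)]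
  have hl14pos : 0 < Real.log 14 := Real.log_pos (by norm_num)
  have hll14 : Real.log (Real.log 14) ≤ 13 := by linarith [Real.log_le_sub_one_of_pos hl14pos]
  have hq : 0 < 14 / (2 * π) := by positivity
  have hlq : Real.log (14 / (2 * π)) ≤ 14 / (2 * π) - 1 := Real.log_le_sub_one_of_pos hq
  have hq3 : 14 / (2 * π) ≤ 7 / 3 := by rw [div_le_iff₀ (by positivity)]; linarith
  have hM : countMain 14 ≤ 5 := by
    unfold countMain
    nlinarith [hlq, hq3, hq]
  have h1 := (abs_le.1 hQ).2
  linarith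

/-- ★ (K) the `(0, 14]` piece of the lower far sum is negligible: `|Σᶠ_{0<Re ρ≤14} ord·φ_dn(Re ρ)| ≤ 10⁻⁹` for `x ≥ T_PT − 67.5`. -/
theorem lowPiece_abs_le {x : ℝ} (hx : T_PT - boxHalfWidth ≤ x) :
    |∑ᶠ ρ ∈ heightBox 0 lowStart, ((analyticOrderAt riemannXiUpper ρ).toNat : ℝ) * phiDn x ρ.re| ≤ 1 / 10 ^ 9 := by
  have hT : T_PT = 3000175332800 := rfl
  have hB : boxHalfWidth = 135 / 2 := rfl
  have hL : lowStart = 14 := rfl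
  rw [hT, hB] at hx
  have hx0 : 0 < x := by linarith
  have hfin := heightBox_finite 0 lowStart
  -- termwise: 0 ≤ ord·φ ≤ ord·φ_dn(14)... bound |Σ| by (Σ ord)·sup φ on (0,14]
  have hsup : ∀ ρ ∈ heightBox 0 lowStart, |((analyticOrderAt riemannXiUpper ρ).toNat : ℝ) * phiDn x ρ.re| ≤
      xiOrd ρ * (2 * x / (x ^ 2 - 14 ^ 2)) := by
    rintro ρ ⟨-, h1, h2⟩
    rw [hL] at h2
    have hφ0 : 0 ≤ phiDn x ρ.re := by
      unfold phiDn; exact div_nonneg (by linarith) (by nlinarith)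
    have hφle : phiDn x ρ.re ≤ 2 * x / (x ^ 2 - 14 ^ 2) := by
      unfold phiDn
      exact div_le_div_of_nonneg_left (by linarith) (by nlinarith) (by nlinarith)
    rw [abs_of_nonneg (mul_nonneg (Nat.cast_nonneg _) hφ0)]
    exact mul_le_mul_of_nonneg_left hφle (Nat.cast_nonneg _)
  have hsum : |∑ᶠ ρ ∈ heightBox 0 lowStart, ((analyticOrderAt riemannXiUpper ρ).toNat : ℝ) * phiDn x ρ.re| ≤
      (∑ᶠ ρ ∈ heightBox 0 lowStart, xiOrd ρ) * (2 * x / (x ^ 2 - 14 ^ 2)) := by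
    rw [finsum_mem_eq_finite_toFinset_sum _ hfin, finsum_mem_eq_finite_toFinset_sum _ hfin, Finset.sum_mul]
    refine (Finset.abs_sum_le_sum_abs _ _).trans (Finset.sum_le_sum fun ρ hρ ↦ ?_)
    exact hsup ρ (hfin.mem_toFinset.1 hρ)
  have hcount : ∑ᶠ ρ ∈ heightBox 0 lowStart, xiOrd ρ ≤ 21 := count_low_le
  have hφ14 : 0 ≤ 2 * x / (x ^ 2 - 14 ^ 2) := div_nonneg (by linarith) (by nlinarith)
  have hnum : 21 * (2 * x / (x ^ 2 - 14 ^ 2)) ≤ 1 / 10 ^ 9 := by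
    rw [← mul_div_assoc, div_le_div_iff₀ (by nlinarith) (by norm_num)]
    nlinarith
  calc _ ≤ (∑ᶠ ρ ∈ heightBox 0 lowStart, xiOrd ρ) * (2 * x / (x ^ 2 - 14 ^ 2)) := hsum
    _ ≤ 21 * (2 * x / (x ^ 2 - 14 ^ 2)) := mul_le_mul_of_nonneg_right hcount hφ14
    _ ≤ 1 / 10 ^ 9 := hnum

/-- ★ (K) **LOWER HALF of LEAF 2, assembled**: the whole lower far sum over heights `(0, x − 67.5]` against MAIN's lower integral:
`|Σᶠ_{0<Re ρ≤x−67.5} ord·φ_dn − (∫_{14}^{x−67.5} φ_dn·log(t/2π))/(2π)| ≤ W_N(x−67.5)·2φ_dn(x−67.5) + 10⁻⁹`. -/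
theorem lowHalf_bound {x : ℝ} (hx : T_PT - boxHalfWidth ≤ x) :
    |∑ᶠ ρ ∈ heightBox 0 (x - boxHalfWidth), ((analyticOrderAt riemannXiUpper ρ).toNat : ℝ) * phiDn x ρ.re
        - (∫ t in lowStart..(x - boxHalfWidth), phiDn x t * Real.log (t / (2 * π))) / (2 * π)|
      ≤ (0.1038 * Real.log (x - boxHalfWidth) + 0.2573 * Real.log (Real.log (x - boxHalfWidth)) + 10.2425)
          * (2 * phiDn x (x - boxHalfWidth)) + 1 / 10 ^ 9 := by
  have hT : T_PT = 3000175332800 := rfl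
  have hB : boxHalfWidth = 135 / 2 := rfl
  have hL : lowStart = 14 := rfl
  have h1 := lowSide_abel hx
  have h2 := lowPiece_abs_le hx
  have hsplit := finsum_heightBox_split (a := 0) (b := lowStart) (c := x - boxHalfWidth) (by rw [hL]; norm_num)
    (by rw [hL, hB]; rw [hT, hB] at hx; linarith)
    (fun ρ ↦ ((analyticOrderAt riemannXiUpper ρ).toNat : ℝ) * phiDn x ρ.re)
  rw [hsplit]
  have key := abs_add_le (∑ᶠ ρ ∈ heightBox 0 lowStart, ((analyticOrderAt riemannXiUpper ρ).toNat : ℝ) * phiDn x ρ.re)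
    (∑ᶠ ρ ∈ heightBox lowStart (x - boxHalfWidth), ((analyticOrderAt riemannXiUpper ρ).toNat : ℝ) * phiDn x ρ.re
      - (∫ t in lowStart..(x - boxHalfWidth), phiDn x t * Real.log (t / (2 * π))) / (2 * π))
  rw [← add_sub_assoc] at key
  linarith

end Summit.RiemannHypothesis.RiemannHypothesis.Theorems.EarlyAppointmentsRemainder0Xi.AbelLowSide
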